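import Literature.Analysis.FunctionSpaces.TorusConvolution
import HarnessLib

/-!
# Approximate identities on the flat torus: `L^p` convergence along a filter, slice-wise and in space–time

Analysis/FunctionSpaces support file (serves the discharge of the Duchon–Robert limit facts of
`Literature.Analysis.FluidPDE.DuchonRobertLocalBalance`, whose mollifier is the torus
periodisation `K_ε` of an arbitrary Euclidean mollifier, indexed by the real parameter
`ε → 0⁺` rather than by a sequence). It upgrades the approximate-identity theorem of
`TorusConvolution` (`Torus.tendsto_eLpNorm_convolution_sub_self`: `L²`, sequences, the fixed
kernels `Torus.kernel εₙ`) to the form in which it is quoted from Evans, *Partial Differential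
Equations*, App. C.4, Thm. 7 (iv) ("`f^ε → f` in `L^p_{loc}(U)` for `1 ≤ p < ∞`"):

* `Torus.tendsto_eLpNorm_convolution_sub_self_of_eventually`: for `θ ∈ L^p(T^d)`,
  `1 ≤ p < ∞`, and kernels `kᵢ` which are *eventually* (along an arbitrary filter `l`)
  nonnegative, continuous, of unit mass, and whose supports shrink into every ball `B(0, δ)`,
  `‖θ ⋆ kᵢ - θ‖_{L^p} → 0` along `l` (density of continuous functions, Young's inequality and
  uniform continuity — the `ε/3` argument of `TorusConvolution`, verbatim);
* `Torus.lintegral_rpow_enorm_convolution_le`: Young's inequality with a unit-mass kernel in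
  the form `∫ |θ ⋆ k|^r ≤ ∫ |θ|^r` (`r ≥ 1`);
* the **space–time** versions for a jointly measurable `θ : α × T^d → ℝ` mollified in the torus
  variable only (`α` any s-finite measure space, in applications the time interval):
  a.e. slice membership `Torus.ae_memLp_of_lintegral_prod_rpow_lt_top`, the space–time Young
  inequality `Torus.lintegral_prod_rpow_enorm_convolution_le`, and the space–time convergence
  `Torus.tendsto_lintegral_prod_rpow_enorm_convolution_sub_self`:
  `∫∫ |θ(a) ⋆ kᵢ - θ(a)|^r → 0` for `∫∫ |θ|^r < ∞` (dominated convergence in `a` along a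
  countably generated filter, Mathlib's `tendsto_lintegral_filter_of_dominated_convergence'`,
  dominated by `2^r ∫ |θ(a)|^r` through Young's inequality).

## Mathlib search

Mathlib (this pin) has group convolution with the *pointwise* approximate-identity theorems
`MeasureTheory.convolution_tendsto_right`, `ContDiffBump.convolution_tendsto_right` and the
estimate `MeasureTheory.dist_convolution_le` (used here through
`Torus.exists_forall_dist_convolution_le`), the density of bounded continuous functions in `L^p`
(`MeasureTheory.MemLp.exists_boundedContinuous_eLpNorm_sub_le`) and dominated convergence for
`lintegral` along countably generated filters
(`MeasureTheory.tendsto_lintegral_filter_of_dominated_convergence'`); it has no `L^p`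
approximate-identity theorem (searched `convolution_tendsto`, `eLpNorm` + `convolution` +
`tendsto`: only the pointwise ones) and nothing on convolution over `UnitAddTorus`
(`Mathlib/Analysis/Fourier/AddCircleMulti` is Fourier-side only). The whole-space analogue in the tree is
`Literature.Analysis.FunctionSpaces.SobolevApprox.tendsto_eLpNorm_convolution_sub_self`
(`SobolevTraceDensityProofs`, finite-dimensional vector spaces with Haar measure), which does not
apply to the compact group `T^d`.

## References

* L. C. Evans, *Partial Differential Equations*, 2nd ed. (AMS 2010), App. C.4, Thm. 7 (iv)
  (properties of mollifiers: `L^p_{loc}` convergence). [Evans2010]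
* R. A. Adams, *Sobolev Spaces* (1975), Lemma 2.18 (c), p. 30. [Adams1975]
-/

noncomputable section

open MeasureTheory TopologicalSpace Set Function Filter Topology Metric ContinuousLinearMap
open scoped ENNReal NNReal Convolution ContDiff InnerProductSpace

namespace Literature.Analysis.FunctionSpaces

namespace Torus

variable {d : Type*} [Fintype d]

/-! ## `L^p` approximate identities along a filter -/

section Slice

/-- **`L^p` convergence of mollifications along a filter** (Evans, App. C.4, Thm. 7 (iv), on
`T^d`): let `θ ∈ L^p(T^d)`, `1 ≤ p < ∞`, and let `kᵢ` be kernels which, eventually along the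
filter `l`, are nonnegative, continuous and of unit mass, and whose supports eventually lie in
every ball `B(0, δ)`, `δ > 0`; then `‖θ ⋆ kᵢ - θ‖_{L^p} → 0` along `l`. (Density of continuous
functions in `L^p`, Mathlib's `MemLp.exists_boundedContinuous_eLpNorm_sub_le`; Young's inequality
`Torus.eLpNorm_convolution_le`; uniform approximation of continuous functions
`Torus.exists_forall_dist_convolution_le`.) [cite: Evans2010, App. C.4 Thm. 7 (iv)] -/
theorem tendsto_eLpNorm_convolution_sub_self_of_eventually {ι : Type*} {l : Filter ι}
    {k : ι → UnitAddTorus d → ℝ}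
    (hk : ∀ᶠ i in l, (∀ y, 0 ≤ k i y) ∧ ∫ y, k i y = 1 ∧ Continuous (k i))
    (hsupp : ∀ δ > 0, ∀ᶠ i in l, support (k i) ⊆ ball 0 δ)
    {p : ℝ≥0∞} (hp : 1 ≤ p) (hp' : p ≠ ⊤) {θ : UnitAddTorus d → ℝ} (hθ : MemLp θ p volume) :
    Tendsto (fun i => eLpNorm (θ ⋆ k i - θ) p volume) l (𝓝 0) := by
  have hθi : Integrable θ volume := hθ.integrable hp
  rw [ENNReal.tendsto_nhds_zero]
  intro ε hε
  -- work with `ε' = min ε 1 < ⊤` and `η = ε' / 3`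
  set ε' : ℝ≥0∞ := min ε 1 with hε'
  have hε'0 : ε' ≠ 0 := (lt_min hε zero_lt_one).ne'
  have hε't : ε' ≠ ⊤ := ((min_le_right _ _).trans_lt ENNReal.one_lt_top).ne
  set η : ℝ≥0∞ := ε' / 3 with hη
  have hη0 : η ≠ 0 := (ENNReal.div_pos_iff.2 ⟨hε'0, by norm_num⟩).ne'
  have hηt : η ≠ ⊤ := ENNReal.div_ne_top hε't (by norm_num)
  -- a continuous `g` close to `θ` in `L^p`
  obtain ⟨gb, hgθ, -⟩ := hθ.exists_boundedContinuous_eLpNorm_sub_le hp' hη0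
  set g : UnitAddTorus d → ℝ := ⇑gb with hg_def
  have hgc : Continuous g := gb.continuous
  have hgi : Integrable g volume := hgc.integrable_unitAddTorus
  -- uniform approximation of `g`
  obtain ⟨δ₀, hδ₀, hU⟩ := exists_forall_dist_convolution_le hgc (ENNReal.toReal_pos hη0 hηt)
  filter_upwards [hk, hsupp δ₀ hδ₀] with i hki hsi
  obtain ⟨hk_nn, hk_int, hk_cont⟩ := hki
  have hk1 : ∫⁻ y, ‖k i y‖ₑ = 1 := by
    rw [lintegral_enorm_eq_ofReal_integral hk_cont.integrable_unitAddTorus hk_nn, hk_int,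
      ENNReal.ofReal_one]
  -- the three pieces
  have hdecomp : θ ⋆ k i - θ = ((θ - g) ⋆ k i) + (g ⋆ k i - g) + (g - θ) := by
    rw [sub_convolution hθi hgi hk_cont]
    abel
  have hm1 : AEStronglyMeasurable ((θ - g) ⋆ k i) volume :=
    (continuous_convolution (hθi.sub hgi) hk_cont).aestronglyMeasurable
  have hm2 : AEStronglyMeasurable (g ⋆ k i - g) volume :=
    ((continuous_convolution hgi hk_cont).sub hgc).aestronglyMeasurable
  have hm3 : AEStronglyMeasurable (g - θ) volume :=
    hgc.aestronglyMeasurable.sub hθ.aestronglyMeasurable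
  have h1 : eLpNorm ((θ - g) ⋆ k i) p volume ≤ η := by
    refine (eLpNorm_convolution_le (hθ.aestronglyMeasurable.sub hgc.aestronglyMeasurable)
      hk_cont.aestronglyMeasurable hp).trans ?_
    rw [hk1, one_mul]
    exact hgθ
  have h2 : eLpNorm (g ⋆ k i - g) p volume ≤ η := by
    have hb : ∀ᵐ x ∂(volume : Measure (UnitAddTorus d)), ‖(g ⋆ k i - g) x‖ ≤ η.toReal :=
      Eventually.of_forall fun x => by
        rw [Pi.sub_apply, convolution_comm_real, ← dist_eq_norm]
        exact hU hsi hk_nn hk_int x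
    refine (eLpNorm_le_of_ae_bound hb).trans ?_
    rw [measure_univ, ENNReal.one_rpow, one_mul, ENNReal.ofReal_toReal hηt]
  have h3 : eLpNorm (g - θ) p volume ≤ η := by
    rw [eLpNorm_sub_comm]
    exact hgθ
  calc eLpNorm (θ ⋆ k i - θ) p volume
      ≤ eLpNorm (((θ - g) ⋆ k i) + (g ⋆ k i - g)) p volume + eLpNorm (g - θ) p volume := by
        rw [hdecomp]
        exact eLpNorm_add_le (hm1.add hm2) hm3 hp
    _ ≤ η + η + η := by
        gcongr
        exact (eLpNorm_add_le hm1 hm2 hp).trans (add_le_add h1 h2)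
    _ = ε' := by rw [hη, ENNReal.add_thirds]
    _ ≤ ε := min_le_left _ _

/-- **Young's inequality with a unit-mass kernel, `L^r` integral form**: for a.e.-strongly
measurable `θ`, a continuous kernel `k ≥ 0` with `∫ k = 1` and `r ≥ 1`,
`∫ |θ ⋆ k|^r ≤ ∫ |θ|^r` on `T^d` (`Torus.eLpNorm_convolution_le`). [folklore] -/
theorem lintegral_rpow_enorm_convolution_le {θ : UnitAddTorus d → ℝ}
    (hθ : AEStronglyMeasurable θ volume) {k : UnitAddTorus d → ℝ} (hk : Continuous k)
    (hk0 : ∀ y, 0 ≤ k y) (hk1 : ∫ y, k y = 1) {r : ℝ} (hr : 1 ≤ r) :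
    ∫⁻ x, ‖(θ ⋆ k) x‖ₑ ^ r ≤ ∫⁻ x, ‖θ x‖ₑ ^ r := by
  have hr0 : 0 < r := one_pos.trans_le hr
  set p : ℝ≥0∞ := ENNReal.ofReal r with hp
  have hp1 : 1 ≤ p := by
    rw [hp, ← ENNReal.ofReal_one]
    exact ENNReal.ofReal_le_ofReal hr
  have hp0 : p ≠ 0 := (zero_lt_one.trans_le hp1).ne'
  have hpt : p ≠ ⊤ := ENNReal.ofReal_ne_top
  have hpr : p.toReal = r := ENNReal.toReal_ofReal hr0.le
  have hk1' : ∫⁻ y, ‖k y‖ₑ = 1 := by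
    rw [lintegral_enorm_eq_ofReal_integral hk.integrable_unitAddTorus hk0, hk1, ENNReal.ofReal_one]
  have h := eLpNorm_convolution_le hθ hk.aestronglyMeasurable hp1
  rw [hk1', one_mul, eLpNorm_eq_lintegral_rpow_enorm_toReal hp0 hpt,
    eLpNorm_eq_lintegral_rpow_enorm_toReal hp0 hpt, hpr] at h
  exact (ENNReal.rpow_le_rpow_iff (one_div_pos.2 hr0)).1 h

end Slice

/-! ## Space–time mollification: `a ↦ θ(a) ⋆ k` for jointly measurable `θ : α × T^d → ℝ` -/

section SpaceTime

variable {α : Type*} [MeasurableSpace α] {μ : Measure α} [SFinite μ]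

omit [SFinite μ] in
/-- **Almost every slice of a jointly `L^r` field is in `L^r`**: if `θ : α × T^d → E` is jointly
a.e.-strongly measurable with `∫∫ ‖θ‖^r < ∞` (`r > 0`), then `θ(a) ∈ L^r(T^d)` for a.e. `a`
(Tonelli). [folklore] -/
theorem ae_memLp_of_lintegral_prod_rpow_lt_top {E : Type*} [NormedAddCommGroup E]
    {θ : α → UnitAddTorus d → E} (hm : AEStronglyMeasurable (uncurry θ) (μ.prod volume))
    {r : ℝ} (hr : 0 < r) (hfin : ∫⁻ z, ‖θ z.1 z.2‖ₑ ^ r ∂(μ.prod volume) < ⊤) :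
    ∀ᵐ a ∂μ, MemLp (θ a) (ENNReal.ofReal r) volume := by
  have hslice : ∀ᵐ a ∂μ, AEStronglyMeasurable (θ a) volume := hm.prodMk_left
  have e : ∫⁻ z, ‖θ z.1 z.2‖ₑ ^ r ∂(μ.prod volume) = ∫⁻ a, ∫⁻ x, ‖θ a x‖ₑ ^ r ∂volume ∂μ :=
    lintegral_prod _ (hm.enorm.pow_const r)
  rw [e] at hfin
  have hint : AEMeasurable (fun a => ∫⁻ x, ‖θ a x‖ₑ ^ r ∂volume) μ :=
    (hm.enorm.pow_const r).lintegral_prod_right'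
  have hfin' : ∀ᵐ a ∂μ, ∫⁻ x, ‖θ a x‖ₑ ^ r ∂volume < ⊤ := ae_lt_top' hint hfin.ne
  filter_upwards [hslice, hfin'] with a h1 h2
  refine ⟨h1, ?_⟩
  rw [eLpNorm_lt_top_iff_lintegral_rpow_enorm_lt_top (ENNReal.ofReal_pos.2 hr).ne'
    ENNReal.ofReal_ne_top, ENNReal.toReal_ofReal hr.le]
  exact h2

/-- **Space–time Young inequality**: for a jointly measurable `θ : α × T^d → ℝ`, a continuous
kernel `k ≥ 0` of unit mass and `r ≥ 1`, `∫∫ |θ(a) ⋆ k|^r ≤ ∫∫ |θ|^r` (Tonelli and the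
slice-wise `Torus.lintegral_rpow_enorm_convolution_le`). [folklore] -/
theorem lintegral_prod_rpow_enorm_convolution_le {θ : α → UnitAddTorus d → ℝ}
    (hm : AEStronglyMeasurable (uncurry θ) (μ.prod volume)) {k : UnitAddTorus d → ℝ}
    (hk : Continuous k) (hk0 : ∀ y, 0 ≤ k y) (hk1 : ∫ y, k y = 1) {r : ℝ} (hr : 1 ≤ r) :
    ∫⁻ z, ‖(θ z.1 ⋆ k) z.2‖ₑ ^ r ∂(μ.prod volume) ≤ ∫⁻ z, ‖θ z.1 z.2‖ₑ ^ r ∂(μ.prod volume) := by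
  have hmc : AEStronglyMeasurable (uncurry fun a x => (θ a ⋆ k) x) (μ.prod volume) :=
    aestronglyMeasurable_uncurry_convolution (lsmul ℝ ℝ) hm hk
  have e1 : ∫⁻ z, ‖(θ z.1 ⋆ k) z.2‖ₑ ^ r ∂(μ.prod volume) =
      ∫⁻ a, ∫⁻ x, ‖(θ a ⋆ k) x‖ₑ ^ r ∂volume ∂μ :=
    lintegral_prod _ (hmc.enorm.pow_const r)
  have e2 : ∫⁻ z, ‖θ z.1 z.2‖ₑ ^ r ∂(μ.prod volume) = ∫⁻ a, ∫⁻ x, ‖θ a x‖ₑ ^ r ∂volume ∂μ :=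
    lintegral_prod _ (hm.enorm.pow_const r)
  rw [e1, e2]
  refine lintegral_mono_ae ?_
  filter_upwards [hm.prodMk_left] with a ha
  have ha' : AEStronglyMeasurable (θ a) volume := ha
  exact lintegral_rpow_enorm_convolution_le ha' hk hk0 hk1 hr

/-- **Space–time `L^r` convergence of mollifications** (Evans, App. C.4, Thm. 7 (iv), integrated
over a parameter): let `θ : α × T^d → ℝ` be jointly measurable with `∫∫ |θ|^r < ∞` (`r ≥ 1`),
and let `kᵢ` be kernels as in `tendsto_eLpNorm_convolution_sub_self_of_eventually` along a
countably generated filter `l`; then `∫∫ |θ(a) ⋆ kᵢ - θ(a)|^r → 0` along `l`. Proof: dominated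
convergence in `a` (Mathlib's `tendsto_lintegral_filter_of_dominated_convergence'`) — at a.e.
`a` the slice is in `L^r` (`ae_memLp_of_lintegral_prod_rpow_lt_top`) and
`‖θ(a) ⋆ kᵢ - θ(a)‖_{L^r} → 0`, with the domination `∫ |θ(a) ⋆ kᵢ - θ(a)|^r ≤ 2^r ∫ |θ(a)|^r`
(Young). [cite: Evans2010, App. C.4 Thm. 7 (iv)] -/
theorem tendsto_lintegral_prod_rpow_enorm_convolution_sub_self {ι : Type*} {l : Filter ι}
    [l.IsCountablyGenerated] {k : ι → UnitAddTorus d → ℝ}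
    (hk : ∀ᶠ i in l, (∀ y, 0 ≤ k i y) ∧ ∫ y, k i y = 1 ∧ Continuous (k i))
    (hsupp : ∀ δ > 0, ∀ᶠ i in l, support (k i) ⊆ ball 0 δ)
    {θ : α → UnitAddTorus d → ℝ} (hm : AEStronglyMeasurable (uncurry θ) (μ.prod volume))
    {r : ℝ} (hr : 1 ≤ r) (hfin : ∫⁻ z, ‖θ z.1 z.2‖ₑ ^ r ∂(μ.prod volume) < ⊤) :
    Tendsto (fun i => ∫⁻ z, ‖(θ z.1 ⋆ k i) z.2 - θ z.1 z.2‖ₑ ^ r ∂(μ.prod volume)) l (𝓝 0) := by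
  have hr0 : 0 < r := one_pos.trans_le hr
  set p : ℝ≥0∞ := ENNReal.ofReal r with hp
  have hp1 : 1 ≤ p := by
    rw [hp, ← ENNReal.ofReal_one]
    exact ENNReal.ofReal_le_ofReal hr
  have hp0 : p ≠ 0 := (zero_lt_one.trans_le hp1).ne'
  have hpt : p ≠ ⊤ := ENNReal.ofReal_ne_top
  have hpr : p.toReal = r := ENNReal.toReal_ofReal hr0.le
  have h2top : (2 : ℝ≥0∞) ^ (r - 1) ≠ ⊤ :=
    ENNReal.rpow_ne_top_of_nonneg (by linarith) ENNReal.ofNat_ne_top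
  have h2r : (2 : ℝ≥0∞) ^ r = 2 ^ (r - 1) * 2 := by
    conv_lhs => rw [show r = (r - 1) + 1 by ring]
    rw [ENNReal.rpow_add _ _ two_ne_zero ENNReal.ofNat_ne_top, ENNReal.rpow_one]
  have h2rt : (2 : ℝ≥0∞) ^ r ≠ ⊤ := ENNReal.rpow_ne_top_of_nonneg hr0.le ENNReal.ofNat_ne_top
  -- slices
  have hslice : ∀ᵐ a ∂μ, MemLp (θ a) p volume :=
    ae_memLp_of_lintegral_prod_rpow_lt_top hm hr0 hfin
  have e2 : ∫⁻ z, ‖θ z.1 z.2‖ₑ ^ r ∂(μ.prod volume) = ∫⁻ a, ∫⁻ x, ‖θ a x‖ₑ ^ r ∂volume ∂μ :=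
    lintegral_prod _ (hm.enorm.pow_const r)
  -- iterated form of the approximants, eventually
  have hmc : ∀ᶠ i in l,
      AEStronglyMeasurable (uncurry fun a x => (θ a ⋆ k i) x - θ a x) (μ.prod volume) := by
    filter_upwards [hk] with i hi
    exact (aestronglyMeasurable_uncurry_convolution (lsmul ℝ ℝ) hm hi.2.2).sub hm
  have e1 : ∀ᶠ i in l, ∫⁻ z, ‖(θ z.1 ⋆ k i) z.2 - θ z.1 z.2‖ₑ ^ r ∂(μ.prod volume) =
      ∫⁻ a, ∫⁻ x, ‖(θ a ⋆ k i) x - θ a x‖ₑ ^ r ∂volume ∂μ := by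
    filter_upwards [hmc] with i hi
    exact lintegral_prod _ (hi.enorm.pow_const r)
  -- dominated convergence in `a`
  set bound : α → ℝ≥0∞ := fun a => 2 ^ r * ∫⁻ x, ‖θ a x‖ₑ ^ r ∂volume with hbound
  have h := tendsto_lintegral_filter_of_dominated_convergence' (μ := μ) (l := l)
    (F := fun i a => ∫⁻ x, ‖(θ a ⋆ k i) x - θ a x‖ₑ ^ r ∂volume) (f := fun _ => 0) bound ?_ ?_ ?_ ?_
  · have h' : Tendsto (fun i => ∫⁻ a, ∫⁻ x, ‖(θ a ⋆ k i) x - θ a x‖ₑ ^ r ∂volume ∂μ) l (𝓝 0) := by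
      simpa only [lintegral_zero] using h
    exact h'.congr' (e1.mono fun i hi => hi.symm)
  · -- measurability
    filter_upwards [hmc] with i hi
    exact (hi.enorm.pow_const r).lintegral_prod_right'
  · -- domination through Young's inequality
    filter_upwards [hk] with i hi
    filter_upwards [hm.prodMk_left] with a ha
    have ha' : AEStronglyMeasurable (θ a) volume := ha
    have hY : ∫⁻ x, ‖(θ a ⋆ k i) x‖ₑ ^ r ∂volume ≤ ∫⁻ x, ‖θ a x‖ₑ ^ r ∂volume :=
      lintegral_rpow_enorm_convolution_le ha' hi.2.2 hi.1 hi.2.1 hr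
    show ∫⁻ x, ‖(θ a ⋆ k i) x - θ a x‖ₑ ^ r ∂volume ≤ 2 ^ r * ∫⁻ x, ‖θ a x‖ₑ ^ r ∂volume
    have hpt' : ∀ x, ‖(θ a ⋆ k i) x - θ a x‖ₑ ^ r ≤
        2 ^ (r - 1) * (‖(θ a ⋆ k i) x‖ₑ ^ r + ‖θ a x‖ₑ ^ r) := fun x =>
      calc ‖(θ a ⋆ k i) x - θ a x‖ₑ ^ r ≤ (‖(θ a ⋆ k i) x‖ₑ + ‖θ a x‖ₑ) ^ r := by
            gcongr
            exact enorm_sub_le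
        _ ≤ _ := ENNReal.rpow_add_le_mul_rpow_add_rpow _ _ hr
    calc ∫⁻ x, ‖(θ a ⋆ k i) x - θ a x‖ₑ ^ r ∂volume
        ≤ ∫⁻ x, 2 ^ (r - 1) * (‖(θ a ⋆ k i) x‖ₑ ^ r + ‖θ a x‖ₑ ^ r) ∂volume :=
          lintegral_mono (hpt' ·)
      _ = 2 ^ (r - 1) * ((∫⁻ x, ‖(θ a ⋆ k i) x‖ₑ ^ r ∂volume) + ∫⁻ x, ‖θ a x‖ₑ ^ r ∂volume) := by
          rw [lintegral_const_mul' _ _ h2top, lintegral_add_right' _ (ha'.enorm.pow_const r)]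
      _ ≤ 2 ^ (r - 1) * ((∫⁻ x, ‖θ a x‖ₑ ^ r ∂volume) + ∫⁻ x, ‖θ a x‖ₑ ^ r ∂volume) := by
          gcongr
      _ = 2 ^ r * ∫⁻ x, ‖θ a x‖ₑ ^ r ∂volume := by
          rw [h2r, ← two_mul, mul_assoc]
  · -- the bound has finite integral
    rw [hbound, lintegral_const_mul' _ _ h2rt, ← e2]
    exact ENNReal.mul_ne_top h2rt hfin.ne
  · -- convergence at a.e. slice
    filter_upwards [hslice] with a ha
    have h1 := tendsto_eLpNorm_convolution_sub_self_of_eventually hk hsupp hp1 hpt ha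
    have h2 : Tendsto (fun i => eLpNorm (θ a ⋆ k i - θ a) p volume ^ r) l (𝓝 0) := by
      have := ((ENNReal.continuous_rpow_const (y := r)).tendsto 0).comp h1
      rwa [ENNReal.zero_rpow_of_pos hr0] at this
    refine h2.congr fun i => ?_
    rw [eLpNorm_eq_lintegral_rpow_enorm_toReal hp0 hpt, hpr, ← ENNReal.rpow_mul,
      one_div_mul_cancel hr0.ne', ENNReal.rpow_one]
    rfl

end SpaceTime

end Torus

end Literature.Analysis.FunctionSpaces
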